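import Summits.KontsevichZagierPeriods.KontsevichZagierPeriods.Theses.TorsionLogs
import Summits.KontsevichZagierPeriods.KontsevichZagierPeriods.Theorems.TorsionLogsNeronTorsionSector

/-!
# F3 WITNESS for the rung `NeronTorsionRealComponents` (line `NeronTorsionOval` on crux `TorsionSectorComplete`,
# stmt-KontsevichZagierPeriods-14212; forward generator G1, seed g1-KontsevichZagierPeriods-17981)

The rung is the Bool-indexed family `NeronTorsionComponentSector` (member `false` = identity component =
`Theses.TorsionLogs.NeronTorsionSector` VERBATIM; member `true` = the oval), `NeronTorsionRealComponents := ∀ b, …`.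
The floor specialises the rung at `b = false`: the seed theorem `Cruxes.NeronTorsionSector.Translation.stub_assembly`
(item stmt-KontsevichZagierPeriods-17981, `NeronTorsionPrimitiveChain`) through the landed bookkeeping
`NeronTorsionSector_of_primitiveChain` IS member `false` (`Iff.rfl`).  No `sorry`.
Self-contained: a verbatim copy of the two `def`s of `Lines/NeronTorsionOval.lean` in the namespace `…NeronTorsionOval.Special`
(the skeleton module proves the same fact about the registered decl as `neronTorsionComponentSector_false`).
[cite: KontsevichZagier2001, §1.2]
-/

noncomputable section

-- `Summit.KontsevichZagierPeriods.KontsevichZagierPeriods.…` is the tree's mandated layout (single-conjunct summit).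
set_option linter.dupNamespace false

namespace Summit.KontsevichZagierPeriods.KontsevichZagierPeriods.Cruxes.TorsionSectorComplete.NeronTorsionOval.Special
open Summit.KontsevichZagierPeriods.KontsevichZagierPeriods.Cruxes.NeronTorsionSector.Translation
  (NeronTorsionSector_of_primitiveChain stub_assembly NeronTorsionSector_of)

/-- Verbatim copy of `Lines/NeronTorsionOval.lean :: NeronTorsionComponentSector`. -/
def NeronTorsionComponentSector : Bool → Prop
  | false => ∀ (g₂ g₃ e₁ xP yP α : ℝ) (N a : ℕ) (M k m : ℤ) (f : ℝ → ℝ), (∀ x, f x = 4 * x ^ 3 - g₂ * x - g₃) → g₂ ^ 3 - 27 * g₃ ^ 2 ≠ 0 → f e₁ = 0 → 0 < e₁ → (∀ x, e₁ < x → 0 < f x) → e₁ < xP → yP ^ 2 = f xP → 3 ≤ N → 0 < a → 2 * a < N → 4 * (N : ℤ) ^ 2 * k = M * ((N : ℤ) - 2 * (a : ℤ)) ^ 2 → (∀ hns : (⟨0, 0, 0, -g₂ / 4, -g₃ / 4⟩ : WeierstrassCurve ℝ).toAffine.Nonsingular xP (yP / 2), addOrderOf (WeierstrassCurve.Affine.Point.some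 xP (yP / 2) hns) = N) → (N : ℝ) * (∫ x in Set.Ioi xP, (Real.sqrt (f x))⁻¹) = a * (2 * ∫ x in Set.Ioi e₁, (Real.sqrt (f x))⁻¹) → 1 < α → ∀ (rI rP : Literature.NumberTheory.Transcendental.KZ.IntegralRep 2) (rL : Literature.NumberTheory.Transcendental.KZ.IntegralRep 1), rI.domain = {z | e₁ < z 1 ∧ z 1 < z 0 ∧ z 0 < xP} → Set.EqOn rI.integrand (fun z => z 1 / (Real.sqrt (f (z 1)) * Real.sqrt (f (z 0)))) rI.domain → rP.domain = {z | e₁ < z 0 ∧ e₁ < z 1} → Set.EqOn rP.integrand (fun z => (Real.sqrt (f (z 0)))⁻¹ * ((g₂ * z 1 + 2 * g₃) / (2 * (z 1) ^ 2 * Real.sqrt (f (z 1))))) rP.domain → rL.domain = {t | 1 < t 0 ∧ t 0 < α} → Set.EqOn rL.integrand (fun t => (t 0)⁻¹) rL.domain → (M : ℝ) * rI.value + k * rP.value = m * rL.value → M • Literature.NumberTheory.Transcendental.KZ.of rI + k • Literature.NumberTheory.Transcendental.KZ.of rP - m • Literature.NumberTheory.Transcendental.KZ.of rL ∈ Lit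erature.NumberTheory.Transcendental.KZ.relations
  | true => ∀ (g₂ g₃ e₂ e₃ xP yP α : ℝ) (N a : ℕ) (M k m : ℤ) (f : ℝ → ℝ), (∀ x, f x = 4 * x ^ 3 - g₂ * x - g₃) → g₂ ^ 3 - 27 * g₃ ^ 2 ≠ 0 → f e₃ = 0 → f e₂ = 0 → e₃ < e₂ → (∀ x, e₃ < x → x < e₂ → 0 < f x) → e₃ < xP → xP < e₂ → yP ^ 2 = f xP → 3 ≤ N → 0 < a → 2 * a < N → (N : ℤ) ^ 2 * k = M * (a : ℤ) ^ 2 → (∀ hns : (⟨0, 0, 0, -g₂ / 4, -g₃ / 4⟩ : WeierstrassCurve ℝ).toAffine.Nonsingular xP (yP / 2), addOrderOf (WeierstrassCurve.Affine.Point.some xP (yP / 2) hns) = N) → (N : ℝ) * (∫ x in Set.Ioo e₃ xP, (Real.sqrt (f x))⁻¹) = a * (2 * ∫ x in Set.Ioo e₃ e₂, (Real.sqrt (f x))⁻¹) → 1 < α → ∀ (rI rP : Literature.NumberTheory.Transcendental.KZ.IntegralRep 2) (rL : Literature.NumberTheory.Transcendental.KZ.IntegralRep 1), rI.domain = {z |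 e₃ < z 1 ∧ z 1 < z 0 ∧ z 0 < xP} → Set.EqOn rI.integrand (fun z => z 1 / (Real.sqrt (f (z 1)) * Real.sqrt (f (z 0)))) rI.domain → rP.domain = {z | e₃ < z 0 ∧ z 0 < e₂ ∧ e₃ < z 1 ∧ z 1 < e₂} → Set.EqOn rP.integrand (fun z => (Real.sqrt (f (z 0)))⁻¹ * (-(2 * z 1) / Real.sqrt (f (z 1)))) rP.domain → rL.domain = {t | 1 < t 0 ∧ t 0 < α} → Set.EqOn rL.integrand (fun t => (t 0)⁻¹) rL.domain → (M : ℝ) * rI.value + k * rP.value = m * rL.value → M • Literature.NumberTheory.Transcendental.KZ.of rI + k • Literature.NumberTheory.Transcendental.KZ.of rP - m • Literature.NumberTheory.Transcendental.KZ.of rL ∈ Literature.NumberTheory.Transcendental.KZ.relations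

/-- Verbatim copy of `Lines/NeronTorsionOval.lean :: NeronTorsionRealComponents` (THE RUNG). -/
def NeronTorsionRealComponents : Prop := ∀ onOval : Bool, NeronTorsionComponentSector onOval

/-- Member `false` is the floor's tied crux on the nose. -/
theorem false_iff : NeronTorsionComponentSector false ↔
    Summit.KontsevichZagierPeriods.KontsevichZagierPeriods.Theses.TorsionLogs.NeronTorsionSector :=
  Iff.rfl

/-- **F3 witness (named):** the floor (seed `stub_assembly`, through the landed bookkeeping) is member `false`. -/
theorem rung_false : NeronTorsionComponentSector false :=
  false_iff.mpr (NeronTorsionSector_of_primitiveChain stub_assembly)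

/-- **F3 witness in the brief's literal shape** `example : Rung <floor parameters> := by simpa [Rung] using <seed>`. -/
example : NeronTorsionComponentSector false := by
  simpa [NeronTorsionComponentSector] using
    (NeronTorsionSector_of_primitiveChain stub_assembly :
      Summit.KontsevichZagierPeriods.KontsevichZagierPeriods.Theses.TorsionLogs.NeronTorsionSector)

/-- The rung restricted to the floor's index is exactly what the floor proves: `Rung ↔ (floor member ∧ oval member)`
with the first conjunct discharged. -/
theorem rung_iff_oval : NeronTorsionRealComponents ↔ NeronTorsionComponentSector true :=
  ⟨fun h => h true, fun h b => by cases b <;> [exact rung_false; exact h]⟩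

end Summit.KontsevichZagierPeriods.KontsevichZagierPeriods.Cruxes.TorsionSectorComplete.NeronTorsionOval.Special

end
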